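import Summits.CriticalPhenomena.CardyFormulaZ2.Theorems.CardySusyWardParafermionFamiliesToSLESixAnchoredWallFluxToggle
import Literature.Probability.Percolation.PercolationEvents

/-!
# The strip anchor (stub S5 of line `strip-anchored-vertex-normalisation`, crux stmt-CriticalPhenomena-10814), IV:
# Darts — the two flux darts of a free-wall site are (unit phase) × (touch probability)

Helper file for `stub_anchoredWallFlux` (conditional form `IkhlefPonsaingFirstPassage → AnchoredWallFlux`).
Admissible data `E`, configuration `ω`, completed configuration `β = E.bcBondConfig ω`, start corner `c₀`,
exit time `T`, cut orbit `orb`. A FREE-WALL SITE is a site `w ∉ A` with `w + e₀, w + e₁ ∈ B` (so the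
edges `s(w, w + e₀)`, `s(w, w + e₁)` are closed in `β`) and inner faces `w - e₀` (and `w`); the TOUCH of
`w` is the dart `(w, 0)` (`E → N` through the face `w`).

* `touch_darts`: a touch `orb n = (w, 0)` (`n < T`) is preceded by the dart `(w, 3)` (`S → E`, a left
  turn: the follow-predecessor `(w + e₀, 1)` would arrive along the closed edge `s(w + e₀, w)`) and
  followed by the dart `orb (n + 1) = (w, 1)` (`N → W`, a left turn across the closed `s(w, w + e₁)`),
  still before the exit (its face `w - e₀` is inner); the turn counts step by `+1, +1`.
* `touch_shift`: if moreover `s(w, w - e₀)` and `s(w - e₀, w - e₀ + e₁)` are open, four steps later the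
  orbit is at `(w - e₀ + e₁, 0)` with the same turn count (turns `+1, -1, -1, +1`).
* `measurableSet_touch`: the touch event `{∃ n < T, orb n = (w, 0)}` is measurable — it is read off
  `β`, which only depends on the finitely many edges of `Ω_δ` (`measurableSet_of_bcBondConfig`,
  registered one-line form `stub_anchor_support`).
* `cornerObs_touch_out` / `cornerObs_touch_in`: if the turn count at the touch is the constant `τ`, the
  corner observable at the two flux corners `(w, w - e₀)` (dart `(w, 1)`) and `(w, w - e₁)` (dart
  `(w, 3)`) equals `sixthPhase (τ ± 1) · P(touch)`: pathwise the corner integrand is the dart weight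
  `S2.dartW` (`S2.cornerIntegrand_explorationList`), which is `sixthPhase (τ ± 1)` on the touch event
  (the dart is carried exactly once, right after / right before the touch) and `0` off it.
-/

noncomputable section

namespace Summit.CriticalPhenomena.CardyFormulaZ2.Theorems.ParafermionFamiliesToSLESix.StripAnchored

open MeasureTheory Function
open Literature.Probability.Percolation (bondPercolation half BondConfig DeterminedBy determinedBy_iff)
open Literature.Probability.LatticeModels
open Literature.Probability.LatticeModels.DiscreteDobrushin (startCorner exitTime isStartCorner_startCorner
  isInnerFace_of_lt_exitTime not_isInnerFace_exitTime medialExploration_eq_explorationList)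
open Summit.CriticalPhenomena.CardyFormulaZ2.Cruxes.EdgePrecompact.QkzStripBoundaryArm (cornerObs)
open S2 (sixthPhase dartW dartW_eq_single dartW_eq_zero cornerIntegrand cornerIntegrand_explorationList
  cornerObs_eq_integral)

namespace S5

variable {E : DiscreteDobrushin} {ω : BondConfig (Site 2)}

/-! ## Events read off the completed configuration are measurable -/

/-- **An event determined by the completed configuration is measurable**: `E.bcBondConfig ω` only
reads `ω` on the finite edge set of `Ω_δ` (`meshDomain_finite`), so such an event is a cylinder event
over a finite index set (`DeterminedBy.measurableSet_of_finset`). [folklore] -/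
theorem measurableSet_of_bcBondConfig (hE : E.IsZdAdmissible) {P : BondConfig (Site 2) → Prop}
    (hP : ∀ ω ω', E.bcBondConfig ω = E.bcBondConfig ω' → (P ω ↔ P ω')) :
    MeasurableSet {ω : BondConfig (Site 2) | P ω} := by
  classical
  set S := (discreteDomainGraph E.Ω E.δ).edgeSet
  -- adapted from `S1.integrable_comp_medialExploration'` (`…VertexCornerBridge.lean`)
  have hfin : S.Finite := by
    have hV : (meshDomain E.Ω E.δ).Finite := meshDomain_finite hE.isBounded hE.delta_pos
    refine ((hV.prod hV).image (fun q : Site 2 × Site 2 => s(q.1, q.2))).subset fun e he => ?_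
    induction e using Sym2.ind with
    | _ a b =>
      have hab := discreteDomainGraph_adj_iff.1 ((SimpleGraph.mem_edgeSet _).1 he)
      exact ⟨(a, b), ⟨hab.2.1, hab.2.2⟩, rfl⟩
  have hbc : ∀ ω : BondConfig (Site 2), E.bcBondConfig (ω ∩ S) = E.bcBondConfig ω := by
    intro ω
    ext e
    simp only [DiscreteDobrushin.mem_bcBondConfig_iff, Set.mem_inter_iff]
    exact ⟨fun ⟨he, h⟩ => ⟨he, h.imp id fun h' => ⟨h'.1.1, h'.2⟩⟩,
      fun ⟨he, h⟩ => ⟨he, h.imp id fun h' => ⟨⟨h'.1, he⟩, h'.2⟩⟩⟩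
  have hdet : DeterminedBy {ω : BondConfig (Site 2) | P ω} (↑hfin.toFinset : Set (Sym2 (Site 2))) := by
    rw [determinedBy_iff]
    intro ω ω' h
    rw [Set.Finite.coe_toFinset] at h
    show P ω ↔ P ω'
    refine hP ω ω' ?_
    rw [← hbc ω, h, hbc ω']
  exact hdet.measurableSet_of_finset

/-- The exit time is a function of the completed configuration. [cite: Smirnov2001, §2] -/
theorem exitTime_congr (hE : E.IsZdAdmissible) {ω ω' : BondConfig (Site 2)}
    (h : E.bcBondConfig ω = E.bcBondConfig ω') : exitTime hE ω = exitTime hE ω' := by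
  refine (exitTime_eq_of hE ω' ?_ ?_).symm
  · rw [← h]; exact not_isInnerFace_exitTime hE ω
  · intro k hk; rw [← h]; exact isInnerFace_of_lt_exitTime hE ω hk

/-- **The touch event `{∃ n < T, orb n = (w, 0)}` is measurable** (it is read off the completed
configuration). [folklore] -/
theorem measurableSet_touch {E : DiscreteDobrushin} (hE : E.IsZdAdmissible) (w : Site 2) :
    MeasurableSet {ω : BondConfig (Site 2) | ∃ n < exitTime hE ω, cornerOrbit (E.bcBondConfig ω) (startCorner hE) n = (w, 0)} :=
  measurableSet_of_bcBondConfig hE fun ω ω' h => by rw [exitTime_congr hE h, h]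

/-! ## Local geometry of the turning rule around a wall site -/

/-- `a + 3 = k` in `Fin 4` forces `a = k + 1`. [folklore] -/
private theorem fin4_eq_add_one_of {a k : Fin 4} (h : a + 3 = k) : a = k + 1 := by
  revert a k; decide

/-- `a + 1 = k` in `Fin 4` forces `a = k + 3`. [folklore] -/
private theorem fin4_eq_add_three_of {a k : Fin 4} (h : a + 1 = k) : a = k + 3 := by
  revert a k; decide

/-- The faces around a touch: `cFace (w, 1) = w - e₀`, `cFace (w - e₀, 0) = w - e₀`,
`cFace (w - e₀ + e₁, 3) = w - e₀`, `cFace (w - e₀ + e₁, 0) = w - e₀ + e₁`, `cFace (w, 3) = w - e₁`,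
`cFace (w, 0) = w`. [folklore] -/
theorem cFace_touch (w : Site 2) :
    cFace (w, 1) = w - cornerUnit 0 ∧ cFace (w - cornerUnit 0, 0) = w - cornerUnit 0 ∧
      cFace (w - cornerUnit 0 + cornerUnit 1, 3) = w - cornerUnit 0 ∧
      cFace (w - cornerUnit 0 + cornerUnit 1, 0) = w - cornerUnit 0 + cornerUnit 1 ∧
      cFace (w, 3) = w - cornerUnit 1 ∧ cFace (w, 0) = w := by
  refine ⟨?_, ?_, ?_, ?_, ?_, ?_⟩ <;> ext i <;> fin_cases i <;> simp [cFace, faceAt, cornerOff, cornerUnit]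

/-- One more step inside: if `m < T` and the face of `orb (m + 1)` is inner then `m + 1 < T` (the exit
time is the first time with a non-inner face). [cite: Smirnov2001, §2] -/
theorem succ_lt_exitTime (hE : E.IsZdAdmissible) {m : ℕ} (hm : m < exitTime hE ω)
    (hin : E.IsInnerFace (cFace (cornerOrbit (E.bcBondConfig ω) (startCorner hE) (m + 1)))) :
    m + 1 < exitTime hE ω := by
  refine lt_of_le_of_ne (Nat.succ_le_of_lt hm) fun h => ?_
  rw [h] at hin
  exact not_isInnerFace_exitTime hE ω hin

/-- **The predecessor of a dart `(w, k)` of the cut orbit** whose vertex `w` is off the arc `A` and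
with `w + cornerUnit k` on the arc `B`: the dart is not the start corner (whose vertex is on `A`), and
it is reached by a left turn from `(w, k + 3)` across the closed edge `cTgt (w, k + 3)` — the
follow-predecessor `(w + cornerUnit k, k + 1)` would arrive along an edge with an endpoint on `B`,
which is closed. [cite: Smirnov2001, §2] -/
theorem orbit_pred (hE : E.IsZdAdmissible) {w : Site 2} {k : Fin 4} (hwA : w ∉ E.zdArcA)
    (hB : w + cornerUnit k ∈ E.zdArcB) {j : ℕ}
    (h : cornerOrbit (E.bcBondConfig ω) (startCorner hE) j = (w, k)) :
    ∃ j', j = j' + 1 ∧ cornerOrbit (E.bcBondConfig ω) (startCorner hE) j' = (w, k + 3) ∧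
      cTgt (w, k + 3) ∉ E.bcBondConfig ω := by
  rcases j with _ | j'
  · refine absurd (isStartCorner_startCorner hE).mem_zdArcA ?_
    rw [show startCorner hE = (w, k) from h]
    exact hwA
  · refine ⟨j', rfl, ?_⟩
    rw [cornerOrbit_succ] at h
    set q := cornerOrbit (E.bcBondConfig ω) (startCorner hE) j' with hq
    by_cases he : cTgt q ∈ E.bcBondConfig ω
    · exfalso
      rw [nextCorner_of_mem he, Prod.mk.injEq] at h
      obtain ⟨h1, h2⟩ := h
      rw [fin4_eq_add_one_of h2, fin4_add_one_add_one, cornerUnit_add_two] at h1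
      have h1' : q.1 = w + cornerUnit k := by rw [← h1]; abel
      have hqB : q.1 ∈ E.zdArcB := by rw [h1']; exact hB
      exact DiscreteDobrushin.not_mem_bcBondConfig_of_mem_zdArcB hE (Sym2.mem_mk_left _ _) hqB he
    · rw [nextCorner_of_not_mem he, Prod.mk.injEq] at h
      have hq' : q = (w, k + 3) := Prod.ext h.1 (fin4_eq_add_three_of h.2)
      exact ⟨hq', hq' ▸ he⟩

/-! ## The darts around a touch -/

/-- **The darts of the exploration around a touch of a free-wall site.** For `w ∉ A` with
`w + e₀, w + e₁ ∈ B` and inner face `w - e₀`, a touch `orb n = (w, 0)`, `n < T`, has `1 ≤ n`,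
predecessor `orb (n - 1) = (w, 3)`, successor `orb (n + 1) = (w, 1)` with `n + 1 < T`, and both turns
(at `n - 1` and at `n`) are left turns: the turn count steps by `+1` twice. [cite: Smirnov2001, §2] -/
theorem touch_darts {E : DiscreteDobrushin} (hE : E.IsZdAdmissible) {w : Site 2}
    (hw1 : E.IsInnerFace (w - cornerUnit 0)) (hB0 : w + cornerUnit 0 ∈ E.zdArcB) (hB1 : w + cornerUnit 1 ∈ E.zdArcB)
    (hwA : w ∉ E.zdArcA) {ω : BondConfig (Site 2)} {n : ℕ} (hn : n < exitTime hE ω)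
    (h : cornerOrbit (E.bcBondConfig ω) (startCorner hE) n = (w, 0)) :
    1 ≤ n ∧ n + 1 < exitTime hE ω ∧
      cornerOrbit (E.bcBondConfig ω) (startCorner hE) (n - 1) = (w, 3) ∧
      cornerOrbit (E.bcBondConfig ω) (startCorner hE) (n + 1) = (w, 1) ∧
      turnCount (E.bcBondConfig ω) (startCorner hE) n = turnCount (E.bcBondConfig ω) (startCorner hE) (n - 1) + 1 ∧
      turnCount (E.bcBondConfig ω) (startCorner hE) (n + 1) = turnCount (E.bcBondConfig ω) (startCorner hE) n + 1 := by
  obtain ⟨e1, -, -, -, -, -⟩ := cFace_touch w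
  obtain ⟨m, rfl, hm, hc3⟩ := orbit_pred hE hwA hB0 h
  have hm' : cornerOrbit (E.bcBondConfig ω) (startCorner hE) m = (w, 3) := hm
  have hc3' : cTgt (w, 3) ∉ E.bcBondConfig ω := hc3
  have hc0 : cTgt (w, 0) ∉ E.bcBondConfig ω :=
    DiscreteDobrushin.not_mem_bcBondConfig_of_mem_zdArcB hE (Sym2.mem_mk_right _ _) hB1
  have hs : cornerOrbit (E.bcBondConfig ω) (startCorner hE) (m + 1 + 1) = (w, 1) := by
    rw [cornerOrbit_succ, h, nextCorner_of_not_mem hc0]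
    rfl
  have hlt : m + 1 + 1 < exitTime hE ω := succ_lt_exitTime hE hn (by rw [hs, e1]; exact hw1)
  refine ⟨Nat.le_add_left 1 m, hlt, by rw [Nat.add_sub_cancel]; exact hm', hs, ?_, ?_⟩
  · rw [Nat.add_sub_cancel, turnCount_succ, hm', turnSign_of_not_mem hc3']
  · rw [turnCount_succ, h, turnSign_of_not_mem hc0]

/-- **Four steps after a touch along two open edges.** If `orb n = (w, 0)` (`n < T`) with
`w + e₁ ∈ B`, inner faces `w - e₀`, `w - e₀ + e₁`, and open edges `s(w, w - e₀)`, `s(w - e₀, w - e₀ + e₁)`,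
then `orb (n + 4) = (w - e₀ + e₁, 0)` with `n + 4 < T` and the same turn count (turns `+1, -1, -1, +1`:
cross `s(w, w + e₁)`, follow the two open edges, cross `s(w - e₀ + e₁, w + e₁)`). [cite: Smirnov2001, §2] -/
theorem touch_shift {E : DiscreteDobrushin} (hE : E.IsZdAdmissible) {w : Site 2}
    (hw1 : E.IsInnerFace (w - cornerUnit 0)) (hB1 : w + cornerUnit 1 ∈ E.zdArcB)
    (hw2 : E.IsInnerFace (w - cornerUnit 0 + cornerUnit 1))
    {ω : BondConfig (Site 2)} {n : ℕ} (hn : n < exitTime hE ω)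
    (h : cornerOrbit (E.bcBondConfig ω) (startCorner hE) n = (w, 0))
    (ho1 : s(w, w - cornerUnit 0) ∈ E.bcBondConfig ω)
    (ho2 : s(w - cornerUnit 0, w - cornerUnit 0 + cornerUnit 1) ∈ E.bcBondConfig ω) :
    n + 4 < exitTime hE ω ∧
      cornerOrbit (E.bcBondConfig ω) (startCorner hE) (n + 4) = (w - cornerUnit 0 + cornerUnit 1, 0) ∧
      turnCount (E.bcBondConfig ω) (startCorner hE) (n + 4) = turnCount (E.bcBondConfig ω) (startCorner hE) n := by
  obtain ⟨e1, e0, e3, e0', -, -⟩ := cFace_touch w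
  -- step 1: cross the closed edge `s(w, w + e₁)`
  have hc0 : cTgt (w, 0) ∉ E.bcBondConfig ω :=
    DiscreteDobrushin.not_mem_bcBondConfig_of_mem_zdArcB hE (Sym2.mem_mk_right _ _) hB1
  have h1 : cornerOrbit (E.bcBondConfig ω) (startCorner hE) (n + 1) = (w, 1) := by
    rw [cornerOrbit_succ, h, nextCorner_of_not_mem hc0]
    rfl
  have hn1 : n + 1 < exitTime hE ω := succ_lt_exitTime hE hn (by rw [h1, e1]; exact hw1)
  -- step 2: follow the open edge `s(w, w - e₀)`
  have hu2 : w + cornerUnit (1 + 1) = w - cornerUnit 0 := by ext i; fin_cases i <;> simp [cornerUnit]; omega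
  have hc1 : cTgt (w, 1) ∈ E.bcBondConfig ω := by
    show s(w, w + cornerUnit (1 + 1)) ∈ E.bcBondConfig ω
    rw [hu2]; exact ho1
  have h2 : cornerOrbit (E.bcBondConfig ω) (startCorner hE) (n + 1 + 1) = (w - cornerUnit 0, 0) := by
    rw [cornerOrbit_succ, h1, nextCorner_of_mem hc1]
    exact Prod.ext hu2 rfl
  have hn2 : n + 1 + 1 < exitTime hE ω := succ_lt_exitTime hE hn1 (by rw [h2, e0]; exact hw1)
  -- step 3: follow the open edge `s(w - e₀, w - e₀ + e₁)`
  have hc2 : cTgt (w - cornerUnit 0, 0) ∈ E.bcBondConfig ω := ho2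
  have h3 : cornerOrbit (E.bcBondConfig ω) (startCorner hE) (n + 1 + 1 + 1) = (w - cornerUnit 0 + cornerUnit 1, 3) := by
    rw [cornerOrbit_succ, h2, nextCorner_of_mem hc2]
    rfl
  have hn3 : n + 1 + 1 + 1 < exitTime hE ω := succ_lt_exitTime hE hn2 (by rw [h3, e3]; exact hw1)
  -- step 4: cross the closed edge `s(w - e₀ + e₁, w + e₁)`
  have hu4 : w - cornerUnit 0 + cornerUnit 1 + cornerUnit (3 + 1) = w + cornerUnit 1 := by
    ext i; fin_cases i <;> simp [cornerUnit]
  have hc3 : cTgt (w - cornerUnit 0 + cornerUnit 1, 3) ∉ E.bcBondConfig ω := by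
    refine DiscreteDobrushin.not_mem_bcBondConfig_of_mem_zdArcB hE (Sym2.mem_mk_right _ _) ?_
    rw [hu4]; exact hB1
  have h4 : cornerOrbit (E.bcBondConfig ω) (startCorner hE) (n + 1 + 1 + 1 + 1) = (w - cornerUnit 0 + cornerUnit 1, 0) := by
    rw [cornerOrbit_succ, h3, nextCorner_of_not_mem hc3]
    rfl
  have hn4 : n + 1 + 1 + 1 + 1 < exitTime hE ω := succ_lt_exitTime hE hn3 (by rw [h4, e0']; exact hw2)
  rw [show n + 4 = n + 1 + 1 + 1 + 1 from rfl]
  refine ⟨hn4, h4, ?_⟩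
  rw [turnCount_succ, h3, turnSign_of_not_mem hc3, turnCount_succ, h2, turnSign_of_mem hc2, turnCount_succ, h1,
    turnSign_of_mem hc1, turnCount_succ, h, turnSign_of_not_mem hc0]
  ring

/-- **After a dart `(w, 3)` comes the touch**, for `w + e₀ ∈ B` (the edge `s(w, w + e₀)` is closed) and
inner face `w`: `orb (j + 1) = (w, 0)` with `j + 1 < T`. [cite: Smirnov2001, §2] -/
theorem touch_of_orbit_three (hE : E.IsZdAdmissible) {w : Site 2} (hw : E.IsInnerFace w)
    (hB0 : w + cornerUnit 0 ∈ E.zdArcB) {j : ℕ} (hj : j < exitTime hE ω)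
    (h : cornerOrbit (E.bcBondConfig ω) (startCorner hE) j = (w, 3)) :
    j + 1 < exitTime hE ω ∧ cornerOrbit (E.bcBondConfig ω) (startCorner hE) (j + 1) = (w, 0) := by
  obtain ⟨-, -, -, -, -, e⟩ := cFace_touch w
  have hc3 : cTgt (w, 3) ∉ E.bcBondConfig ω :=
    DiscreteDobrushin.not_mem_bcBondConfig_of_mem_zdArcB hE (Sym2.mem_mk_right _ _) hB0
  have h1 : cornerOrbit (E.bcBondConfig ω) (startCorner hE) (j + 1) = (w, 0) := by
    rw [cornerOrbit_succ, h, nextCorner_of_not_mem hc3]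
    rfl
  exact ⟨succ_lt_exitTime hE hj (by rw [h1, e]; exact hw), h1⟩

/-! ## The two flux darts of a wall site -/

/-- The common integration step: if pathwise the weight `dartW` of the coded corner `r` (vertex `v`,
face `f`) is the indicator of the touch event times the constant `c`, then `cornerObs E E.δ v f` is `c`
times the touch probability. [folklore] -/
theorem cornerObs_eq_of_dartW (hE : E.IsZdAdmissible) {r : Site 2 × Fin 4} {v f : Site 2} (h1 : r.1 = v)
    (h2 : cFace r = f) (w : Site 2) (c : ℂ)
    (hW : ∀ ω : BondConfig (Site 2), dartW (E.bcBondConfig ω) (startCorner hE) r (exitTime hE ω) =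
      Set.indicator {ω : BondConfig (Site 2) | ∃ n < exitTime hE ω,
        cornerOrbit (E.bcBondConfig ω) (startCorner hE) n = (w, 0)} (fun _ => c) ω) :
    cornerObs E E.δ v f = c * (((bondPercolation (zdGraph 2) half).real
      {ω : BondConfig (Site 2) | ∃ n < exitTime hE ω, cornerOrbit (E.bcBondConfig ω) (startCorner hE) n = (w, 0)} : ℝ) : ℂ) := by
  rw [cornerObs_eq_integral]
  have key : ∀ ω : BondConfig (Site 2), cornerIntegrand E.δ v f (medialExploration E ω) =
      Set.indicator {ω : BondConfig (Site 2) | ∃ n < exitTime hE ω,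
        cornerOrbit (E.bcBondConfig ω) (startCorner hE) n = (w, 0)} (fun _ => c) ω := fun ω => by
    rw [medialExploration_eq_explorationList hE ω, cornerIntegrand_explorationList hE.delta_pos.ne' _ _ _ h1 h2, hW]
  simp_rw [key]
  rw [integral_indicator_const c (measurableSet_touch hE w), Complex.real_smul, mul_comm]

/-- **The outgoing flux dart `(w, 1)` of a free-wall site: `G(w, w - e₀) = sixthPhase (τ + 1) · P(touch)`.**
For `w ∉ A`, `w + e₀, w + e₁ ∈ B`, inner faces `w`, `w - e₀`, and constant turn count `τ` at the touch:
on the touch event the dart `(w, 1)` is carried exactly once, right after the touch, with turn count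
`τ + 1` (`touch_darts`); off it, never (a dart `(w, 1)` is preceded by the touch, `orbit_pred`).
[cite: DuminilCopin2012Parafermion, Proposition 5] -/
theorem cornerObs_touch_out {E : DiscreteDobrushin} (hE : E.IsZdAdmissible) {w : Site 2} (hw : E.IsInnerFace w)
    (hw1 : E.IsInnerFace (w - cornerUnit 0)) (hB0 : w + cornerUnit 0 ∈ E.zdArcB) (hB1 : w + cornerUnit 1 ∈ E.zdArcB)
    (hwA : w ∉ E.zdArcA) (τ : ℤ)
    (hτ : ∀ (ω : BondConfig (Site 2)) (n : ℕ), n < exitTime hE ω →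
      cornerOrbit (E.bcBondConfig ω) (startCorner hE) n = (w, 0) → turnCount (E.bcBondConfig ω) (startCorner hE) n = τ) :
    cornerObs E E.δ w (w - cornerUnit 0) =
      sixthPhase (τ + 1) * (((bondPercolation (zdGraph 2) half).real
        {ω : BondConfig (Site 2) | ∃ n < exitTime hE ω, cornerOrbit (E.bcBondConfig ω) (startCorner hE) n = (w, 0)} : ℝ) : ℂ) := by
  have _unused := hw -- `hw` is part of the shared signature of the two flux darts; only the ingoing one needs it
  obtain ⟨e1, -, -, -, -, -⟩ := cFace_touch w
  refine cornerObs_eq_of_dartW hE (r := (w, 1)) rfl e1 w _ fun ω => ?_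
  by_cases ht : ω ∈ {ω : BondConfig (Site 2) | ∃ n < exitTime hE ω,
      cornerOrbit (E.bcBondConfig ω) (startCorner hE) n = (w, 0)}
  · rw [Set.indicator_of_mem ht]
    obtain ⟨n, hn, h⟩ := ht
    obtain ⟨-, h2, -, h4, -, h6⟩ := touch_darts hE hw1 hB0 hB1 hwA hn h
    rw [dartW_eq_single h2 fun j hj => ?_, h6, hτ ω n hn h]
    constructor
    · intro hj1
      obtain ⟨j', rfl, hj', -⟩ := orbit_pred hE hwA hB1 hj1
      have hj'' : cornerOrbit (E.bcBondConfig ω) (startCorner hE) j' = (w, 0) := hj'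
      have := orbit_inj hE (fun k hk => isInnerFace_of_lt_exitTime hE ω hk) (show j' < exitTime hE ω by omega) hn
        (hj''.trans h.symm)
      omega
    · rintro rfl; exact h4
  · rw [Set.indicator_of_notMem ht]
    refine dartW_eq_zero fun j hj hj1 => ht ?_
    obtain ⟨j', rfl, hj', -⟩ := orbit_pred hE hwA hB1 hj1
    exact ⟨j', by omega, hj'⟩

/-- **The ingoing flux dart `(w, 3)` of a free-wall site: `G(w, w - e₁) = sixthPhase (τ - 1) · P(touch)`.**
Same hypotheses: on the touch event the dart `(w, 3)` is carried exactly once, right before the touch,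
with turn count `τ - 1` (`touch_darts`); off it, never (a dart `(w, 3)` is followed by the touch, still
before the exit since the face `w` is inner, `touch_of_orbit_three`). [cite: DuminilCopin2012Parafermion, Proposition 5] -/
theorem cornerObs_touch_in {E : DiscreteDobrushin} (hE : E.IsZdAdmissible) {w : Site 2} (hw : E.IsInnerFace w)
    (hw1 : E.IsInnerFace (w - cornerUnit 0)) (hB0 : w + cornerUnit 0 ∈ E.zdArcB) (hB1 : w + cornerUnit 1 ∈ E.zdArcB)
    (hwA : w ∉ E.zdArcA) (τ : ℤ)
    (hτ : ∀ (ω : BondConfig (Site 2)) (n : ℕ), n < exitTime hE ω →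
      cornerOrbit (E.bcBondConfig ω) (startCorner hE) n = (w, 0) → turnCount (E.bcBondConfig ω) (startCorner hE) n = τ) :
    cornerObs E E.δ w (w - cornerUnit 1) =
      sixthPhase (τ - 1) * (((bondPercolation (zdGraph 2) half).real
        {ω : BondConfig (Site 2) | ∃ n < exitTime hE ω, cornerOrbit (E.bcBondConfig ω) (startCorner hE) n = (w, 0)} : ℝ) : ℂ) := by
  obtain ⟨-, -, -, -, e3, -⟩ := cFace_touch w
  refine cornerObs_eq_of_dartW hE (r := (w, 3)) rfl e3 w _ fun ω => ?_
  by_cases ht : ω ∈ {ω : BondConfig (Site 2) | ∃ n < exitTime hE ω,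
      cornerOrbit (E.bcBondConfig ω) (startCorner hE) n = (w, 0)}
  · rw [Set.indicator_of_mem ht]
    obtain ⟨n, hn, h⟩ := ht
    obtain ⟨h1, -, h3, -, h5, -⟩ := touch_darts hE hw1 hB0 hB1 hwA hn h
    have hτ' : turnCount (E.bcBondConfig ω) (startCorner hE) (n - 1) = τ - 1 := by
      have := hτ ω n hn h; omega
    rw [dartW_eq_single (show n - 1 < exitTime hE ω by omega) fun j hj => ?_, hτ']
    constructor
    · intro hj3
      obtain ⟨hj', h0⟩ := touch_of_orbit_three hE hw hB0 hj hj3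
      have := orbit_inj hE (fun k hk => isInnerFace_of_lt_exitTime hE ω hk) hj' hn (h0.trans h.symm)
      omega
    · rintro rfl; exact h3
  · rw [Set.indicator_of_notMem ht]
    refine dartW_eq_zero fun j hj hj3 => ht ?_
    obtain ⟨hj', h0⟩ := touch_of_orbit_three hE hw hB0 hj hj3
    exact ⟨j + 1, hj', h0⟩

end S5

/-- **Registered one-line form `stub_anchor_support`** of `S5.measurableSet_of_bcBondConfig` (helper of
stub S5 `stub_anchoredWallFlux`): an event determined by the completed configuration is measurable.
[folklore] -/
theorem stub_anchor_support : ∀ (E : DiscreteDobrushin), E.IsZdAdmissible → ∀ (P : BondConfig (Site 2) → Prop), (∀ ω ω', E.bcBondConfig ω = E.bcBondConfig ω' → (P ω ↔ P ω')) → MeasurableSet {ω | P ω} :=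
  fun _ hE _ hP => S5.measurableSet_of_bcBondConfig hE hP

end Summit.CriticalPhenomena.CardyFormulaZ2.Theorems.ParafermionFamiliesToSLESix.StripAnchored

end
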